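import Literature.MathematicalPhysics.QuantumFieldTheory.Balaban1983to89.T4ApexVariance

/-!
# Per-string hybrid-NE7 data ⇔ per-string matching modulo constants: the DEGENERATE CLASS EXPANSION
# (`T4MatchingAssembly.StringHybridNE7` with one class, no bad class, no shells)

STATEMENTS AND QUANTIFIER BOOKKEEPING ONLY (apex lineage, additive leaf beside `T4ApexVariance`; seat `pub-ymgap-dag-n23-b`, YM-PLAN
Track A, in support of the detail route's spine rung).  Nothing analytic is proved or asserted; nothing of Bałaban's series is used.

The tree types node U5's per-string output in TWO currencies: King's shape «matching of the dressed partition functions of consecutive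
runs MODULO `t`-INDEPENDENT CONSTANTS with a summable remainder» ([King1986] (3.10)–(3.13) pp. 656–657, the `d = 3` template;
`T4CauchySum.MatchingModConstants`, per string `T4ApexVariance.StringwiseMatching`, under the prefix `T4ApexVariance.MatchingUnder`), and
the HYBRID class-expansion packaging of the two runs' dressed partition functions `Z_K(t) = Σ_τ A_K(t,τ)`, `Z_{K+1}(t) = Σ_τ B_K(t,τ)` with
a bad-class weight budget (NE7b), an indicator-shell budget (NE7c) and term-wise core matching (`T4MatchingAssembly.HybridNE7`,
`StringHybridNE7`, per string `T4ApexHybrid.StringwiseHybridNE7`, under the prefix `T4ApexHybrid.HybridNE7Under` = binder B5 of the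
headline).  The direction hybrid ⇒ matching is node U5 (`T4MatchingAssembly.matchingModConstants_schemeZ`,
`T4ApexVariance.stringwiseMatching_of_stringwiseHybridNE7`, `matchingUnder_of_hybridNE7Under`).

THIS FILE: the CONVERSE, by the degenerate expansion — ONE class (`ι := Unit`), `A_K(t, ⋆) := Z_{K₀+K}(t)`, `B_K(t, ⋆) := Z_{K₀+K+1}(t)`,
EMPTY bad class, ZERO shells, ZERO weight budgets: every field of `RelWeightBound` ∕ `ShellWeightBound` is then `0 ≤ 0`, `∅ ⊆ T`, `0 < 1`,
`Summable 0` or `0 ≤ Z` (positivity of dressed partition functions, `T4GenFunBounds.dressedZ_pos`), and the `core` field IS matching modulo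
constants, exponentiated (`stringHybridNE7_of_matchingModConstants`).  Hence, for a scheme with `β_K ≥ 0` and measurable observables bounded
by `1`: `StringwiseHybridNE7 S ↔ StringwiseMatching S` (`stringwiseHybridNE7_iff_stringwiseMatching`; the volume factor's sign is
normalised away, `matchingModConstants_one_of_any`), and under the targets' prefix, for data with measurable averaging maps,
`HybridNE7Under D Hβ ↔ MatchingUnder D Hβ` (`hybridNE7Under_iff_matchingUnder`; printed-averaged data: `…_of_printed`).

READING (why it is recorded): the hybrid packaging — bad classes, shells, budgets `W_K + Wsh_K < 1` — is BOOKKEEPING for how NE7b ∕ NE7c ∕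
NE7-core are to be proved along Bałaban's runs; as a HYPOTHESIS SHAPE it carries exactly the content of King-shape matching modulo
constants, no more.  In particular binder B5 `HybridNE7Under D (…)` of `T4ContinuumYM4Torus.continuumYM4_torus_of_endpointExistence` and the
detail route's third rung read, at any datum, precisely «per-string matching modulo constants of the Wilson scheme `D.scheme g₀` along the
datum's tuned bare couplings».  HONEST FRAMING: bookkeeping equivalence of two typings; the estimates themselves (NE7, NE7b, NE7c for
`d = 4`) are NOT in print and NOT proved; one finite four-torus; nothing about `ℝ⁴`, infinite volume, OS axioms, a mass gap or Clay.
-/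

noncomputable section

open MeasureTheory

namespace Literature.MathematicalPhysics.QuantumFieldTheory.Balaban1983to89

open Missing T4Continuum T4CauchySum T4MatchingAssembly T4ApexVariance

namespace T4MatchingDegenerate

universe u

/-! ## 1. Scheme level, one string: matching modulo constants from `K₀` on ⇒ the degenerate hybrid-NE7 datum -/

section Scheme

variable {G : Type*} [GaugeGroup G] [MeasurableSpace G] [RegularGaugeGroup G] [HaarData G] {O : Type*}

/-- **Volume-factor normalisation**: matching modulo constants with ANY volume factor `vol` and summable remainder `δ` is matching modulo
constants with volume factor `1` and the summable remainder `|vol|·|δ_K|`. [cite: King1986, (3.10)–(3.13) pp.656–657 (shape; elementary bookkeeping of the tree's typing)] -/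
theorem matchingModConstants_one_of_any {vol l₀ : ℝ} {δ : ℕ → ℝ} {Z : ℕ → ℝ → ℝ}
    (h : MatchingModConstants vol l₀ δ Z) : MatchingModConstants 1 l₀ (fun K => |vol| * |δ K|) Z := fun K => by
  obtain ⟨c, hc⟩ := h K
  refine ⟨c, fun t ht => ?_⟩
  show _ ≤ 1 * (|vol| * |δ K|)
  rw [one_mul, ← abs_mul]
  exact (hc t ht).trans (le_abs_self _)

/-- **THE DEGENERATE CLASS EXPANSION**: for a scheme with `β_K ≥ 0` and measurable observables bounded by `1`, matching modulo constants of
the string's dressed partition functions from step `K₀` on — `∀ K, ∃ c, ∀ |t| ≤ l₀, |log Z_{K₀+K+1}(t) − log Z_{K₀+K}(t) − c| ≤ vol·δ_K` with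
`Σ δ_K < ∞` — IS a hybrid-NE7 datum `StringHybridNE7 S os l₀ vol K₀`: one class, empty bad class, zero shells, zero budgets; the `core`
field is the matching inequality exponentiated (`Z > 0`, `T4GenFunBounds.dressedZ_pos`). [cite: King1986, (3.10)–(3.13) pp.656–657 (shape; the tree's hybrid packaging degenerates to it)] -/
theorem stringHybridNE7_of_matchingModConstants (S : TorusScheme G O) (hβ : ∀ K, 0 ≤ S.β K)
    (hm : ∀ K o, Measurable (S.obs K o)) (h1 : ∀ K o U, |S.obs K o U| ≤ 1) (os : List O) {l₀ vol : ℝ} {K₀ : ℕ}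
    {δ : ℕ → ℝ} (hδ : Summable δ)
    (hM : MatchingModConstants vol l₀ δ fun K => T4GenFunBounds.schemeZ S os (K₀ + K)) :
    StringHybridNE7 S os l₀ vol K₀ := by
  classical
  -- positivity of the dressed partition functions
  have hZpos : ∀ K t, 0 < T4GenFunBounds.schemeZ S os K t := fun K t =>
    T4GenFunBounds.dressedZ_pos (S.P K) (hβ K) (T4GenFunBounds.measurable_prodObs S hm K os)
      (T4GenFunBounds.abs_prodObs_le_one S h1 K os) t
  refine ⟨Unit, inferInstance, fun _ => Finset.univ,
    fun K t _ => T4GenFunBounds.schemeZ S os (K₀ + K) t, fun K t _ => T4GenFunBounds.schemeZ S os (K₀ + K + 1) t,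
    fun _ _ _ => 0, fun _ _ _ => 0, fun _ _ => ∅, fun _ => 0, fun _ => 0, δ, ?_, ?_, ?_⟩
  · refine
      { weight := ?_, shell := ?_, lt_one := fun _ => by norm_num, summable := hδ, core := ?_ }
    · exact
        { bad_subset := fun _ _ _ => Finset.empty_subset _
          nonneg := fun _ => le_rfl
          lt_one := fun _ => zero_lt_one
          summable := summable_zero
          bad_left := fun _ _ _ => by simp
          bad_right := fun _ _ _ => by simp }
    · exact
        { nonneg := fun _ => le_rfl
          summable := summable_zero
          sh_nonneg_left := fun _ _ _ _ _ => le_rfl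
          sh_le_left := fun K t _ _ _ => (hZpos (K₀ + K) t).le
          sh_nonneg_right := fun _ _ _ _ _ => le_rfl
          sh_le_right := fun K t _ _ _ => (hZpos (K₀ + K + 1) t).le
          left := fun _ _ _ => by simp
          right := fun _ _ _ => by simp }
    · intro K
      obtain ⟨c, hc⟩ := hM K
      refine ⟨c, fun t ht _ _ => ?_⟩
      have hA := hZpos (K₀ + K) t
      have hB := hZpos (K₀ + K + 1) t
      have h := abs_le.mp (hc t ht)
      simp only [← Nat.add_assoc] at h
      -- `|log B − log A − c| ≤ vol δ_K`, exponentiated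
      have hlo : Real.log (T4GenFunBounds.schemeZ S os (K₀ + K) t) + (c - vol * δ K) ≤
          Real.log (T4GenFunBounds.schemeZ S os (K₀ + K + 1) t) := by linarith [h.1]
      have hhi : Real.log (T4GenFunBounds.schemeZ S os (K₀ + K + 1) t) ≤
          Real.log (T4GenFunBounds.schemeZ S os (K₀ + K) t) + (c + vol * δ K) := by linarith [h.2]
      rw [sub_zero, sub_zero]
      constructor
      · have := Real.exp_le_exp.mpr hlo
        rwa [Real.exp_add, Real.exp_log hA, Real.exp_log hB, mul_comm] at this
      · have := Real.exp_le_exp.mpr hhi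
        rwa [Real.exp_add, Real.exp_log hA, Real.exp_log hB, mul_comm] at this
  · intro K t _; simp
  · intro K t _; simp

/-- **PER STRING, ALL STRINGS: King-shape matching ⇒ hybrid-NE7 data** (`StringwiseMatching S → StringwiseHybridNE7 S`), for a scheme with
`β_K ≥ 0` and measurable observables bounded by `1` (volume factor normalised to `1`, expansion from `K₀ = 0`). [cite: King1986, (3.10)–(3.13) pp.656–657 (shape)] -/
theorem stringwiseHybridNE7_of_stringwiseMatching (S : TorusScheme G O) (hβ : ∀ K, 0 ≤ S.β K)
    (hm : ∀ K o, Measurable (S.obs K o)) (h1 : ∀ K o U, |S.obs K o U| ≤ 1) (h : StringwiseMatching S) :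
    T4ApexHybrid.StringwiseHybridNE7 S := fun os => by
  obtain ⟨l₀, vol, δ, hl₀, hδ, hM⟩ := h os
  have hM1 := matchingModConstants_one_of_any hM
  have h0 : (fun K => T4GenFunBounds.schemeZ S os (0 + K)) = T4GenFunBounds.schemeZ S os := by
    funext K; rw [Nat.zero_add]
  refine ⟨l₀, 1, 0, hl₀, one_pos, stringHybridNE7_of_matchingModConstants S hβ hm h1 os (hδ.abs.mul_left |vol|) ?_⟩
  rw [h0]
  exact hM1

/-- **THE TWO PER-STRING CURRENCIES COINCIDE**: `StringwiseHybridNE7 S ↔ StringwiseMatching S` for a scheme with `β_K ≥ 0` and measurable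
observables bounded by `1` (⇒ is node U5, `T4ApexVariance.stringwiseMatching_of_stringwiseHybridNE7`; ⇐ the degenerate expansion). [cite: King1986, (3.10)–(3.13) pp.656–657 (shape; bookkeeping equivalence of the tree's two typings)] -/
theorem stringwiseHybridNE7_iff_stringwiseMatching (S : TorusScheme G O) (hβ : ∀ K, 0 ≤ S.β K)
    (hm : ∀ K o, Measurable (S.obs K o)) (h1 : ∀ K o U, |S.obs K o U| ≤ 1) :
    T4ApexHybrid.StringwiseHybridNE7 S ↔ StringwiseMatching S :=
  ⟨stringwiseMatching_of_stringwiseHybridNE7 S hβ hm h1, stringwiseHybridNE7_of_stringwiseMatching S hβ hm h1⟩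

end Scheme

/-! ## 2. Under the targets' prefix: binder B5 ⇔ node U5's King-shape output -/

section Prefix

variable {F : T4Family} {G : Type u} [GaugeGroup G] [MeasurableSpace G] [RegularGaugeGroup G] [HaarData G]

/-- **`MatchingUnder ⇒ HybridNE7Under`** for data with measurable averaging maps (the averaged loop variables are measurable and bounded by
`1`, `FiniteEpsData.measurable_avgObs` ∕ `abs_avgObs_le_one`; `β_K ≥ 0`, `FiniteEpsData.scheme_β_eq`) — the converse of
`T4ApexVariance.matchingUnder_of_hybridNE7Under`, any β-side hypothesis `Hβ`. [cite: King1986, (3.10)–(3.13) pp.656–657 (shape)] -/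
theorem hybridNE7Under_of_matchingUnder (D : FiniteEpsData F G) (hM : D.AvgMeasurable) {Hβ : Prop}
    (h : MatchingUnder D Hβ) : T4ApexHybrid.HybridNE7Under D Hβ :=
  FiniteEpsData.UnderHypotheses.mono (fun g₀ hg =>
    stringwiseHybridNE7_of_stringwiseMatching (D.scheme g₀) (fun K => (D.scheme_β_eq g₀ K).2)
      (fun K C => D.measurable_avgObs hM K C) (fun K C U => D.abs_avgObs_le_one K C U) hg) h

/-- **BINDER B5 ⇔ NODE U5's OUTPUT UNDER THE PREFIX**: `HybridNE7Under D Hβ ↔ MatchingUnder D Hβ` for data with measurable averaging maps,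
any β-side hypothesis. [cite: King1986, (3.10)–(3.13) pp.656–657 (shape; bookkeeping equivalence of the tree's two typings)] -/
theorem hybridNE7Under_iff_matchingUnder (D : FiniteEpsData F G) (hM : D.AvgMeasurable) (Hβ : Prop) :
    T4ApexHybrid.HybridNE7Under D Hβ ↔ MatchingUnder D Hβ :=
  ⟨matchingUnder_of_hybridNE7Under D hM, hybridNE7Under_of_matchingUnder D hM⟩

end Prefix

/-! ## 3. Printed-averaged data on `SU(N)` (no measurability hypothesis left) -/

section Printed

variable {F : T4Family} {N : ℕ} [NeZero N] {D : FiniteEpsData F (Matrix.specialUnitaryGroup (Fin N) ℂ)}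

/-- For printed-averaged data on `SU(N)` (binder B1; measurability by `IsPrintedAveraged.avgMeasurable`) binder B5 in the print-faithful
form IS node U5's King-shape output under endpoint existence: `HybridNE7Under D (EndpointExistence …) ↔ MatchingUnder D (EndpointExistence …)`. [cite: King1986, (3.10)–(3.13) pp.656–657 (shape)] -/
theorem hybridNE7Under'_iff_matchingUnder'_of_printed (hD : D.IsPrintedAveraged) :
    T4ApexHybrid.HybridNE7Under D (DagBinding.EndpointExistence D.C.toB12) ↔
      MatchingUnder D (DagBinding.EndpointExistence D.C.toB12) :=
  hybridNE7Under_iff_matchingUnder D hD.avgMeasurable _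

/-- The same in the scoping-note hypothesis form `BetaPertHyp D.βfun`. [cite: King1986, (3.10)–(3.13) pp.656–657 (shape)] -/
theorem hybridNE7Under_iff_matchingUnder_of_printed (hD : D.IsPrintedAveraged) :
    T4ApexHybrid.HybridNE7Under D (BetaPertHyp D.βfun) ↔ MatchingUnder D (BetaPertHyp D.βfun) :=
  hybridNE7Under_iff_matchingUnder D hD.avgMeasurable _

end Printed

end T4MatchingDegenerate

end Literature.MathematicalPhysics.QuantumFieldTheory.Balaban1983to89

end
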